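import Mathlib
import Summits.KontsevichZagierPeriods.Zeta5Search.TypeSpaceAggregate
import Summits.KontsevichZagierPeriods.Zeta5Search.SecondOrderCollinearityProof
import HarnessLib

/-!
# ζ(5) search — the TYPE-SPACE LAW, zero regime (`ResidueLaw.TypeSpaceLawZero`), conditional on the rational residue sums

Cell `pub-zeta5` (HONEST FRAMING: systematic search; no irrationality claim unless certified), typer seat generation 11.
REPORT-gen2-g11 §4, THEOREM W (Z): `typeSpaceLawZero_of_residues` proves the conclusion `v_p(Cas_j(b)) ≥ 6 − 2M` of the tree statement
`ResidueLaw.TypeSpaceLawZero` from its class hypotheses (pole classes `E ≥ −M`, `M ≥ 6` even; pole classes of exponent `−M`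
non-self-conjugate with palindromic type list; the doubled orbit points of the live classes AFFINELY collinear mod `p`) and, in place of
the degree condition DEG, the two RATIONAL RESIDUE CONGRUENCES `Res₀(b) ≡ 0`, `Res₀(b + e_j) ≡ 0 (mod p)`,
`Res₀(c) := Σ_{pole, E = −M} ĝ_xφ_x + Σ_{pole, E = −M+1} ĝ_x` (the rational lift of the `h = 1` residue sum of `ResidueLaw.ResidueIdentityB`;
DEG for `b` gives DEG-with-`−2` for `b + e_j` since `Σ_x E_x` rises by at most `2`).  What remains for `TypeSpaceLawZero` BY NAME is therefore
`ResidueIdentityB` (finite-field residue theorem, gen-2 g11 §2) plus the reduction bridge `ĝ_x mod p = gBar`, `ĝ_xφ_x mod p = gBar·phiBar`.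
Proof: `aggregate₃` for `b` and `b + e_j` (`G1_shift`, `G3_shift`), `point_transfer` (the points of `b + e_j` are points of `b`), the residue
congruences make both aggregates AFFINE combinations `Σ k_z (P_z − P_{x₀})`, whose determinant expands into the affine cross products
`affDet x₀ z w ≡ 0`; then `det_small₂`.  `p`-adic valuations of rational numbers; nothing here bears on irrationality.
-/

noncomputable section

open Finset

namespace Summit.KontsevichZagierPeriods.Zeta5Search.SecondOrder

open Summit.KontsevichZagierPeriods.Zeta5Search.DualSeries (InBox)
open Summit.KontsevichZagierPeriods.Zeta5Search.WedgeDictionary (coeffW coeffV)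
open Summit.KontsevichZagierPeriods.Zeta5Search.CasoratianValuation (InPolytope shift casoratian)
open Summit.KontsevichZagierPeriods.Zeta5Search.ClusterValuation
open Summit.KontsevichZagierPeriods.Zeta5Search.PadicSeries
open Summit.KontsevichZagierPeriods.Zeta5Search.BigPrime (shift_zero)
open Summit.KontsevichZagierPeriods.Zeta5Search.ResidueLaw (pointW pointV liveClasses affDet)

variable {p : ℕ} [hp : Fact p.Prime]

/-! ## §1 Integrality of the orbit points -/

/-- `‖τ_W‖ ≤ 1`, `‖τ_V‖ ≤ 1`. -/
theorem padicNorm_tau_le_one (b : ℕ → ℤ) (h0 : 0 ≤ b 0) (hn : (b 0).toNat < p ^ 2) (hp2 : p ≠ 2) (x : ℕ) :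
    padicNorm p (tauW b p x) ≤ 1 ∧ padicNorm p (tauV b p x) ≤ 1 := by
  have h2 : padicNorm p (2 : ℚ) = 1 := padicNorm_two hp2
  have hL : padicNorm p ((topLevel b p x : ℕ) : ℚ) ≤ 1 := by simpa using padicNorm.of_nat (p := p) (topLevel b p x)
  have key : ∀ {u v : ℚ}, padicNorm p u ≤ 1 → padicNorm p v ≤ 1 →
      padicNorm p (2 * u - (topLevel b p x : ℚ) * v) ≤ 1 := fun hu hv => by
    refine (padicNorm.sub (p := p)).trans (max_le ?_ ?_)
    · rw [padicNorm.mul, h2, one_mul]; exact hu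
    · rw [padicNorm.mul]
      calc _ ≤ (1 : ℚ) * 1 := mul_le_mul hL hv (padicNorm.nonneg _) zero_le_one
        _ = 1 := one_mul _
  unfold tauW tauV
  exact ⟨key (padicNorm_wHat2_le_one b h0 hn hp2 x) (LevelClass.padicNorm_wHat_le_one b h0 hn hp2 x),
    key (padicNorm_vHat2_le_one b h0 hn hp2 x) (LevelClass.padicNorm_vHat_le_one b h0 hn hp2)⟩

/-- `‖P_W‖ ≤ 1`, `‖P_V‖ ≤ 1` for the doubled orbit points. -/
theorem padicNorm_point_le_one (b : ℕ → ℤ) (h0 : 0 ≤ b 0) (hn : (b 0).toNat < p ^ 2) (hp2 : p ≠ 2) (M x : ℕ) :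
    padicNorm p (pointW b p M x) ≤ 1 ∧ padicNorm p (pointV b p M x) ≤ 1 := by
  have h2 : padicNorm p (2 : ℚ) = 1 := padicNorm_two hp2
  have h4 : padicNorm p (4 : ℚ) = 1 := by rw [show (4 : ℚ) = 2 * 2 by norm_num, padicNorm.mul, h2, one_mul]
  have hw : ∀ z, padicNorm p (wHat b p z) ≤ 1 := fun z => LevelClass.padicNorm_wHat_le_one b h0 hn hp2 z
  have hv : ∀ z, padicNorm p (vHat b p z) ≤ 1 := fun z => LevelClass.padicNorm_vHat_le_one b h0 hn hp2
  have hτ : ∀ z, padicNorm p (tauW b p z) ≤ 1 ∧ padicNorm p (tauV b p z) ≤ 1 := fun z => padicNorm_tau_le_one b h0 hn hp2 z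
  constructor
  · unfold pointW
    by_cases hE : classExp b p x = -(M : ℤ)
    · rw [if_pos hE]
      exact (padicNorm.nonarchimedean (p := p)).trans (max_le (hτ x).1 (hτ (conjClass b p x)).1)
    · rw [if_neg hE]
      by_cases hc : CentreIn b p x
      · rw [if_pos hc, padicNorm.mul, h4, one_mul]; exact hw x
      · rw [if_neg hc, padicNorm.mul, h2, one_mul]
        unfold orbitW; rw [if_neg hc]
        exact (padicNorm.nonarchimedean (p := p)).trans (max_le (hw _) (hw _))
  · unfold pointV
    by_cases hE : classExp b p x = -(M : ℤ)
    · rw [if_pos hE]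
      exact (padicNorm.nonarchimedean (p := p)).trans (max_le (hτ x).2 (hτ (conjClass b p x)).2)
    · rw [if_neg hE]
      by_cases hc : CentreIn b p x
      · rw [if_pos hc, padicNorm.mul, h4, one_mul]; exact hv x
      · rw [if_neg hc, padicNorm.mul, h2, one_mul]
        unfold orbitV; rw [if_neg hc]
        exact (padicNorm.nonarchimedean (p := p)).trans (max_le (hv _) (hv _))

/-! ## §2 The type-space law, zero regime, from the residue congruences -/

/-- **TYPE-SPACE LAW, ZERO REGIME, conditional form.**  The class hypotheses of `ResidueLaw.TypeSpaceLawZero` together with the two rational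
residue congruences `‖Res₀(b)‖ ≤ p⁻¹`, `‖Res₀(b + e_j)‖ ≤ p⁻¹` give `v_p(Cas_j(b)) ≥ 6 − 2M`. -/
theorem typeSpaceLawZero_of_residues (b : ℕ → ℤ) (p j M : ℕ) (hb : InPolytope b) (hb' : InPolytope (shift b j))
    (hj1 : 1 ≤ j) (hj7 : j ≤ 7) (hprime : p.Prime) (hp5 : 5 ≤ p) (hpb : (p : ℤ) ≤ b 0) (hwin : (b 0 + 2 : ℤ) < (p : ℤ) ^ 2)
    (hM : 6 ≤ M) (hMe : Even M)
    (G1 : ∀ x, x < p → 1 ≤ classPoleCount b p x → -(M : ℤ) ≤ classExp b p x)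
    (G3 : ∀ x, x < p → 1 ≤ classPoleCount b p x → classExp b p x = -(M : ℤ) →
      ¬ CentreIn b p x ∧ (classTypeList b p x).reverse = classTypeList b p x)
    (HA : ∀ x ∈ liveClasses b p M, ∀ y ∈ liveClasses b p M, ∀ z ∈ liveClasses b p M,
      affDet b p M x y z = 0 ∨ 1 ≤ padicValRat p (affDet b p M x y z))
    (hres : padicNorm p
      ((∑ z ∈ (range p).filter (fun x => 1 ≤ classPoleCount b p x ∧ classExp b p x = -(M : ℤ)), gHat b p z * phiHat b p z)
        + ∑ z ∈ (range p).filter (fun x => 1 ≤ classPoleCount b p x ∧ classExp b p x = -(M : ℤ) + 1), gHat b p z)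
      ≤ (p : ℚ) ^ (-(1 : ℤ)))
    (hres' : padicNorm p
      ((∑ z ∈ (range p).filter (fun x => 1 ≤ classPoleCount (shift b j) p x ∧ classExp (shift b j) p x = -(M : ℤ)),
          gHat (shift b j) p z * phiHat (shift b j) p z)
        + ∑ z ∈ (range p).filter (fun x => 1 ≤ classPoleCount (shift b j) p x ∧ classExp (shift b j) p x = -(M : ℤ) + 1),
          gHat (shift b j) p z)
      ≤ (p : ℚ) ^ (-(1 : ℤ)))
    (hcas : casoratian b j ≠ 0) : (6 : ℤ) - 2 * M ≤ padicValRat p (casoratian b j) := by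
  haveI : Fact p.Prime := ⟨hprime⟩
  have hp0 : (p : ℚ) ≠ 0 := Nat.cast_ne_zero.2 hprime.ne_zero
  have hpneg : (-(p : ℚ)) ≠ 0 := neg_ne_zero.2 hp0
  have hp2 : p ≠ 2 := by omega
  have h0 : 0 ≤ b 0 := hb.1.1
  obtain ⟨-, -, -, hn⟩ := thmA_data b hb hwin
  have h4n : padicNorm p (4 : ℚ) = 1 := by
    rw [show (4 : ℚ) = 2 * 2 by norm_num, padicNorm.mul, padicNorm_two hp2, one_mul]
  -- the aggregates for `b` and `b + e_j`
  obtain ⟨X, Y, k, hX1, hY1, hW, hV, hk1, hkL, hksum, hXa, hYa⟩ := aggregate₃ b hb hp5 hpb hwin hM hMe G1 G3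
  have hpb' : (p : ℤ) ≤ shift b j 0 := by rw [shift_zero b hj1]; exact hpb
  have hwin' : (shift b j 0 + 2 : ℤ) < (p : ℤ) ^ 2 := by rw [shift_zero b hj1]; exact hwin
  obtain ⟨X', Y', k', hX1', hY1', hW', hV', hk1', hkL', hksum', hXa', hYa'⟩ := aggregate₃ (shift b j) hb' hp5 hpb' hwin' hM hMe
    (G1_shift b hb hj1 G1) (G3_shift b hb hb' hj1 hj7 hpb G1 G3)
  -- the points of `b + e_j` are points of `b`
  have hPt : ∀ z, k' z ≠ 0 → z ∈ liveClasses b p M ∧ pointW (shift b j) p M z = pointW b p M z ∧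
      pointV (shift b j) p M z = pointV b p M z := fun z hz =>
    point_transfer b hb hb' hj1 hj7 hpb hM hMe G1 G3 (hkL' z hz)
  -- a base point
  obtain ⟨x₀, hx₀⟩ : ∃ x₀, ∀ z ∈ liveClasses b p M, x₀ ∈ liveClasses b p M := by
    by_cases h : (liveClasses b p M).Nonempty
    · obtain ⟨x, hx⟩ := h; exact ⟨x, fun _ _ => hx⟩
    · exact ⟨0, fun z hz => absurd ⟨z, hz⟩ h⟩
  have hP0 := padicNorm_point_le_one b h0 hn hp2 M x₀
  -- the weight sums are `O(p)`
  have hsum : padicNorm p (∑ z ∈ range p, k z) ≤ (p : ℚ) ^ (-(1 : ℤ)) := by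
    have e : ∑ z ∈ range p, k z = (4 * ∑ z ∈ range p, k z) / 4 := by ring
    rw [e, padicNorm.div, h4n, div_one, hksum]; exact hres
  have hsum' : padicNorm p (∑ z ∈ range p, k' z) ≤ (p : ℚ) ^ (-(1 : ℤ)) := by
    have e : ∑ z ∈ range p, k' z = (4 * ∑ z ∈ range p, k' z) / 4 := by ring
    rw [e, padicNorm.div, h4n, div_one, hksum']; exact hres'
  -- the affine aggregates
  set u₁ := ∑ z ∈ range p, k z * (pointW b p M z - pointW b p M x₀) with hu₁
  set u₂ := ∑ z ∈ range p, k z * (pointV b p M z - pointV b p M x₀) with hu₂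
  set u₁' := ∑ z ∈ range p, k' z * (pointW (shift b j) p M z - pointW b p M x₀) with hu₁'
  set u₂' := ∑ z ∈ range p, k' z * (pointV (shift b j) p M z - pointV b p M x₀) with hu₂'
  have haff : ∀ {Z : ℚ} {c f : ℕ → ℚ} {P : ℚ}, padicNorm p (Z - ∑ z ∈ range p, c z * f z) ≤ (p : ℚ) ^ (-(1 : ℤ)) →
      padicNorm p (∑ z ∈ range p, c z) ≤ (p : ℚ) ^ (-(1 : ℤ)) → padicNorm p P ≤ 1 →
      padicNorm p (Z - ∑ z ∈ range p, c z * (f z - P)) ≤ (p : ℚ) ^ (-(1 : ℤ)) := by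
    intro Z c f P hZ hc hP
    have e1 : ∑ z ∈ range p, c z * (f z - P) = (∑ z ∈ range p, c z * f z) - (∑ z ∈ range p, c z) * P := by
      rw [sum_mul, ← sum_sub_distrib]
      exact sum_congr rfl fun z _ => by ring
    have e : Z - ∑ z ∈ range p, c z * (f z - P) = (Z - ∑ z ∈ range p, c z * f z) + (∑ z ∈ range p, c z) * P := by
      rw [e1]; ring
    rw [e]
    refine (padicNorm.nonarchimedean (p := p)).trans (max_le hZ ?_)
    rw [padicNorm.mul]
    calc _ ≤ (p : ℚ) ^ (-(1 : ℤ)) * 1 := mul_le_mul hc hP (padicNorm.nonneg _) (zpow_p_nonneg _)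
      _ = _ := mul_one _
  have hXu : padicNorm p (X - u₁) ≤ (p : ℚ) ^ (-(1 : ℤ)) := haff hXa hsum hP0.1
  have hYu : padicNorm p (Y - u₂) ≤ (p : ℚ) ^ (-(1 : ℤ)) := haff hYa hsum hP0.2
  have hXu' : padicNorm p (X' - u₁') ≤ (p : ℚ) ^ (-(1 : ℤ)) := haff hXa' hsum' hP0.1
  have hYu' : padicNorm p (Y' - u₂') ≤ (p : ℚ) ^ (-(1 : ℤ)) := haff hYa' hsum' hP0.2
  -- ### the affine direction determinant is `O(p)`
  have hdir : padicNorm p (u₁' * u₂ - u₁ * u₂') ≤ (p : ℚ) ^ (-(1 : ℤ)) := by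
    rw [hu₁, hu₂, hu₁', hu₂', mul_comm (∑ z ∈ range p, k z * (pointW b p M z - pointW b p M x₀)), sum_mul_sum, sum_mul_sum,
      ← sum_sub_distrib]
    refine padicNorm.sum_le' (fun z hz => ?_) (zpow_p_nonneg _)
    rw [← sum_sub_distrib]
    refine padicNorm.sum_le' (fun w hw => ?_) (zpow_p_nonneg _)
    have e : k' z * (pointW (shift b j) p M z - pointW b p M x₀) * (k w * (pointV b p M w - pointV b p M x₀))
        - k' z * (pointV (shift b j) p M z - pointV b p M x₀) * (k w * (pointW b p M w - pointW b p M x₀)) =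
        k' z * k w * ((pointW (shift b j) p M z - pointW b p M x₀) * (pointV b p M w - pointV b p M x₀)
          - (pointV (shift b j) p M z - pointV b p M x₀) * (pointW b p M w - pointW b p M x₀)) := by ring
    rw [e]
    refine padicNorm_coeff_mul_le (hk1' z) (hk1 w) fun hα hβ => ?_
    obtain ⟨hzL, hPW, hPV⟩ := hPt z hα
    have hwL := hkL w hβ
    rw [hPW, hPV]
    exact padicNorm_le_of_zero_or_val (HA x₀ (hx₀ z hzL) z hzL w hwL)
  -- ### the minor
  set w := coeffW b / (-(p : ℚ)) ^ (-(M : ℤ) + 3)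
  set v := coeffV b / (-(p : ℚ)) ^ (-(M : ℤ))
  set w' := coeffW (shift b j) / (-(p : ℚ)) ^ (-(M : ℤ) + 3)
  set v' := coeffV (shift b j) / (-(p : ℚ)) ^ (-(M : ℤ))
  have hdet := det_small₂ hW hV hW' hV' hX1 hY1 hX1' hY1' hXu hYu hXu' hYu' hdir
  have hcasE : casoratian b j = (-(p : ℚ)) ^ (-(M : ℤ) + 3) * (-(p : ℚ)) ^ (-(M : ℤ)) * (w' * v - w * v') := by
    have e1 : coeffW b = w * (-(p : ℚ)) ^ (-(M : ℤ) + 3) := by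
      simp only [w]; rw [div_mul_cancel₀ _ (zpow_ne_zero _ hpneg)]
    have e2 : coeffV b = v * (-(p : ℚ)) ^ (-(M : ℤ)) := by
      simp only [v]; rw [div_mul_cancel₀ _ (zpow_ne_zero _ hpneg)]
    have e3 : coeffW (shift b j) = w' * (-(p : ℚ)) ^ (-(M : ℤ) + 3) := by
      simp only [w']; rw [div_mul_cancel₀ _ (zpow_ne_zero _ hpneg)]
    have e4 : coeffV (shift b j) = v' * (-(p : ℚ)) ^ (-(M : ℤ)) := by
      simp only [v']; rw [div_mul_cancel₀ _ (zpow_ne_zero _ hpneg)]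
    unfold casoratian
    rw [e1, e2, e3, e4]; ring
  apply val_ge_of_padicNorm_le hcas
  rw [hcasE, padicNorm.mul, padicNorm.mul, LevelClass.padicNorm_neg_p_zpow, LevelClass.padicNorm_neg_p_zpow]
  calc (p : ℚ) ^ (-(-(M : ℤ) + 3)) * (p : ℚ) ^ (-(-(M : ℤ))) * padicNorm p (w' * v - w * v')
      ≤ (p : ℚ) ^ (-(-(M : ℤ) + 3)) * (p : ℚ) ^ (-(-(M : ℤ))) * (p : ℚ) ^ (-(3 : ℤ)) :=
        mul_le_mul_of_nonneg_left hdet (mul_nonneg (zpow_p_nonneg _) (zpow_p_nonneg _))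
    _ = (p : ℚ) ^ (-((6 : ℤ) - 2 * M)) := by
        rw [← zpow_add₀ hp0, ← zpow_add₀ hp0]; congr 1; ring

end Summit.KontsevichZagierPeriods.Zeta5Search.SecondOrder

end
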